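import Literature.RepresentationTheory.FiniteGroups.InducedCharacter
import Literature.RepresentationTheory.FiniteGroups.BrauerTheorem
import Literature.RepresentationTheory.FiniteGroups.NonabelianCharDegree
import HarnessLib

/-!
# Coefficient calculus in the basis of irreducible characters

Topic `Literature/RepresentationTheory/FiniteGroups`; theorems only (no definition, no named fact).
Small API over the tree's character theory of a finite group `K` over `ℂ` (`IsIrrChar`, `irrChars`,
`IsCharacter`, `IsClassFun`, `classInner`; orthonormality `IsIrrChar.classInner_eq` and completeness
`IsClassFun.eq_sum_classInner_smul` of `IrreducibleCharacters`), in the form used by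
`AmalgamCompatibleCharacters` (compatible characters of an amalgam of finite groups):

* `classInner_sum_smul_irrChars_subtype` — coefficient extraction `⟨∑_χ a_χ χ, χ₀⟩ = a_{χ₀}`
  (Serre §2.3 Thm. 3);
* `IsClassFun.eq_sum_subtype_classInner_smul`, `IsClassFun.eq_of_forall_classInner_eq` —
  completeness (Serre §2.5 Thm. 6) with sums over the finite TYPE of irreducible characters, and
  "a class function is determined by its scalar products with the irreducible characters";
* `IsCharacter.exists_nat_classInner_eq` — multiplicities `⟨θ, κ⟩ ∈ ℕ` (Serre §2.3 Thm. 4);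
* `sum_subtype_apply_one_smul_irrChars_apply` — `∑_χ χ(1) χ = r_K`, the regular character
  (Serre §2.4 Cor. 1), evaluated: `|K| δ_{s,1}`;
* `isCharacter_sum_subtype_natCast_smul_irrChars` — `ℕ`-combinations of irreducible characters are
  characters; `isClassFun_sum_smul_irrChars_subtype`; `IsClassFun.comp_monoidHom`;
  `classInner_sum_smul_comp` (linearity of `f ↦ ⟨f ∘ φ, κ⟩`); `IsIrrChar.exists_apply_one_eq_nat_pos`
  (degrees are positive integers, via the tree's `pos_of_mem_charDegrees`).

The lemmas about "the" set of irreducible characters are stated for a `Finset` `S` with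
`∀ χ, χ ∈ S ↔ IsIrrChar K χ` (resp. only `→` where that suffices), so that callers may keep the finite
set opaque; `S = (irrChars_finite_holds K).toFinset` is the canonical instance.

## References

* J.-P. Serre, *Linear Representations of Finite Groups*, GTM 42 (1977), §2.3 Thm. 3–4, §2.4
  Cor. 1, §2.5 Thm. 6. [SerreLinearRepresentations1977]
-/

noncomputable section

open scoped BigOperators

namespace Literature.RepresentationTheory.FiniteGroups

/-! ### Single-group lemmas: coefficient calculus in the basis of irreducible characters -/

section OneGroup

variable {K : Type} [Group K]

/-- A class function composed with a homomorphism is a class function (Serre §2.5: pull-back of a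
function constant on conjugacy classes). [cite: SerreLinearRepresentations1977, §2.5] -/
theorem IsClassFun.comp_monoidHom {H : Type} [Group H] {f : K → ℂ} (hf : IsClassFun f)
    (φ : H →* K) : IsClassFun (f ∘ φ) := by
  intro s t
  simp only [Function.comp_apply, map_mul, map_inv]
  exact hf (φ s) (φ t)

/-- The degree `χ(1)` of an irreducible character is a positive natural number (Serre §2.1 Prop. 1
(i): `χ(1) = n`, the dimension of a non-zero space). [cite: SerreLinearRepresentations1977, §2.1 Prop. 1] -/
theorem IsIrrChar.exists_apply_one_eq_nat_pos {χ : K → ℂ} (h : IsIrrChar K χ) :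
    ∃ d : ℕ, 0 < d ∧ χ 1 = d := by
  obtain ⟨d, hd, h1⟩ := h.exists_apply_one
  exact ⟨d, pos_of_mem_charDegrees hd, h1⟩

/-- Bilinearity of the scalar product (Serre §2.3, Remark after Thm. 3): `⟨(∑_χ a_χ g_χ) ∘ φ, κ⟩ =
∑_χ a_χ ⟨g_χ ∘ φ, κ⟩`. [cite: SerreLinearRepresentations1977, §2.3 Remark] -/
theorem classInner_sum_smul_comp {H : Type} [Group H] [Fintype H] {α : Type} (s : Finset α)
    (φ : H →* K) (g : α → K → ℂ) (a : α → ℂ) (κ : H → ℂ) :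
    classInner ((∑ χ ∈ s, a χ • g χ) ∘ φ) κ = ∑ χ ∈ s, a χ * classInner (g χ ∘ φ) κ := by
  have : ((∑ χ ∈ s, a χ • g χ) ∘ ⇑φ) = ∑ χ ∈ s, a χ • (g χ ∘ ⇑φ) := by
    funext h
    simp only [Function.comp_apply, Finset.sum_apply, Pi.smul_apply, smul_eq_mul]
  rw [this, classInner_sum_left]
  exact Finset.sum_congr rfl fun χ _ => classInner_smul_left _ _ _

/-- A combination of irreducible characters is a class function (Serre §2.5: the characters lie in
the space of class functions). [cite: SerreLinearRepresentations1977, §2.5 Prop. 6] -/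
theorem isClassFun_sum_smul_irrChars_subtype {S : Finset (K → ℂ)}
    (hS : ∀ χ, χ ∈ S → IsIrrChar K χ) (a : ↥S → ℂ) :
    IsClassFun (∑ χ : ↥S, a χ • (χ : K → ℂ)) := by
  intro s t
  simp only [Finset.sum_apply, Pi.smul_apply, smul_eq_mul]
  refine Finset.sum_congr rfl fun χ _ => ?_
  rw [(hS χ χ.2).isCharacter.isClassFun s t]

/-- A combination of irreducible characters with natural-number coefficients is a character.
[cite: SerreLinearRepresentations1977, §2.3 Thm. 4] -/
theorem isCharacter_sum_subtype_natCast_smul_irrChars {S : Finset (K → ℂ)}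
    (hS : ∀ χ, χ ∈ S → IsIrrChar K χ) (n : ↥S → ℕ) :
    IsCharacter K (∑ χ : ↥S, ((n χ : ℕ) : ℂ) • (χ : K → ℂ)) := by
  refine IsCharacter.sum fun χ _ => ?_
  rw [Nat.cast_smul_eq_nsmul ℂ]
  exact (hS χ χ.2).isCharacter.nsmul _

variable [Fintype K]

/-- Restriction multiplicities are natural numbers: for a character `θ` and an irreducible
character `κ` of a finite group, `⟨θ, κ⟩ ∈ ℕ`. [cite: SerreLinearRepresentations1977, §2.3 Thm. 4] -/
theorem IsCharacter.exists_nat_classInner_eq {θ : K → ℂ} (hθ : IsCharacter K θ) {κ : K → ℂ}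
    (hκ : IsIrrChar K κ) : ∃ n : ℕ, classInner θ κ = n := by
  obtain ⟨m, hm, rfl⟩ := hθ.exists_multiset_irrChars
  exact ⟨m.count κ, classInner_multiset_sum_irrChars hm hκ⟩

/-- Two class functions with the same scalar products against all irreducible characters are equal
(completeness). [cite: SerreLinearRepresentations1977, §2.5 Thm. 6] -/
theorem IsClassFun.eq_of_forall_classInner_eq {f g : K → ℂ} (hf : IsClassFun f) (hg : IsClassFun g)
    (h : ∀ κ : K → ℂ, IsIrrChar K κ → classInner f κ = classInner g κ) : f = g := by
  rw [hf.eq_sum_classInner_smul, hg.eq_sum_classInner_smul]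
  exact Finset.sum_congr rfl fun κ hκ => by
    rw [h κ ((irrChars_finite_holds K).mem_toFinset.mp hκ)]

/-! The following lemmas are stated for a `Finset` `S` of functions `K → ℂ` which IS the set of
irreducible characters (`hS : ∀ χ, χ ∈ S ↔ IsIrrChar K χ`); sums run over the finite type `↥S`. -/

/-- Coefficient extraction by orthonormality: `⟨∑_χ a_χ χ, χ₀⟩ = a_{χ₀}` for a combination of the
irreducible characters and `χ₀` irreducible. [cite: SerreLinearRepresentations1977, §2.3 Thm. 3] -/
theorem classInner_sum_smul_irrChars_subtype {S : Finset (K → ℂ)} (hS : ∀ χ, χ ∈ S → IsIrrChar K χ)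
    (a : ↥S → ℂ) (χ₀ : ↥S) :
    classInner (∑ χ : ↥S, a χ • (χ : K → ℂ)) χ₀ = a χ₀ := by
  classical
  rw [classInner_sum_left]
  have : ∀ χ ∈ (Finset.univ : Finset ↥S),
      classInner (a χ • (χ : K → ℂ)) χ₀ = if χ = χ₀ then a χ₀ else 0 := by
    intro χ _
    rw [classInner_smul_left, IsIrrChar.classInner_eq (hS χ χ.2) (hS χ₀ χ₀.2)]
    by_cases h : χ = χ₀
    · subst h; simp
    · rw [if_neg (fun e => h (Subtype.ext e)), if_neg h, mul_zero]
  rw [Finset.sum_congr rfl this, Finset.sum_ite_eq' _ χ₀, if_pos (Finset.mem_univ _)]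

/-- Completeness in subtype-indexed form: a class function is the combination
`∑_χ ⟨f, χ⟩ χ` over the (finite type of) irreducible characters.
[cite: SerreLinearRepresentations1977, §2.5 Thm. 6] -/
theorem IsClassFun.eq_sum_subtype_classInner_smul {S : Finset (K → ℂ)}
    (hS : ∀ χ, χ ∈ S ↔ IsIrrChar K χ) {f : K → ℂ} (hf : IsClassFun f) :
    f = ∑ χ : ↥S, classInner f χ • (χ : K → ℂ) := by
  obtain rfl : S = (irrChars_finite_holds K).toFinset :=
    Finset.ext fun χ => by rw [hS, Set.Finite.mem_toFinset]; rfl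
  rw [Finset.sum_coe_sort (irrChars_finite_holds K).toFinset (fun χ => classInner f χ • χ)]
  exact hf.eq_sum_classInner_smul

/-- **The regular character in the basis of irreducible characters**: `∑_χ χ(1) χ = r_K`, so
`(∑_χ χ(1) χ)(s) = |K| δ_{s,1}` (Serre §2.4 Prop. 5 and Cor. 1).
[cite: SerreLinearRepresentations1977, §2.4 Cor. 1] -/
theorem sum_subtype_apply_one_smul_irrChars_apply [DecidableEq K] {S : Finset (K → ℂ)}
    (hS : ∀ χ, χ ∈ S ↔ IsIrrChar K χ) (s : K) :
    (∑ χ : ↥S, (χ : K → ℂ) 1 • (χ : K → ℂ)) s = if s = 1 then (Fintype.card K : ℂ) else 0 := by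
  have hreg := (isCharacter_leftRegular (G := K)).isClassFun.eq_sum_subtype_classInner_smul hS
  have : (∑ χ : ↥S, (χ : K → ℂ) 1 • (χ : K → ℂ)) = (Representation.leftRegular ℂ K).character := by
    rw [hreg]
    exact Finset.sum_congr rfl fun χ _ => by rw [classInner_leftRegular]
  rw [this, character_leftRegular]

end OneGroup

end Literature.RepresentationTheory.FiniteGroups

end
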